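import Mathlib
import HarnessLib
import Summits.HubbardSuperconductivity.HubbardSuperconductivity.Theorems.KLProgrammeKLRegimeTwoVolumeTowerSrcScaledDefs
import Summits.HubbardSuperconductivity.HubbardSuperconductivity.Theorems.KLProgrammeKLRegimeTwoVolumeTowerBaseDefs

/-!
# Route `KLProgramme` — crux K3, VL child (stmt-HubbardSuperconductivity-20440), keying option «(VL)-SRC-WINDOW» of the located item «VL-BASE-DEFECT»:
# THE SOURCE-SMOOTHING ENDOMORPHISM (definitions; seat hubbard-kl-k3c4-p1 g16, filed by g17 per the pen's (R235) «KEY = WINDOW»; definition lane)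

p3 g18's «BASE-SRC-ROWS» (p641676): the plain source copy of the VL tower is read through the half-range Dirichlet kernel of the `4M` grid, `ℓ¹ ≍ ln M`.  The
window key (k3c4-p1 g16, KL STATUS 15:54Z/16:35Z; pen (R235)): smooth every SOURCE leg (copy `1` of the doubled labels) in imaginary time by the
Matsubara-frequency window `w_j = χ((2n_j+1)/M)`, `χ(x) = smoothTransition((4/3)(1 − x²))` (`C^∞`, values in `[0,1]`, `≡ 1` on the inner half of the band
`|2n_j+1| ≤ M/2`, `≡ 0` at the band edge `|2n_j+1| ≥ M`; p3 g18's profile of `…TowerBaseSrcWindowRows.windowBlock_wtRows_le`), i.e. apply the algebra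
endomorphism `srcSmooth = ExteriorAlgebra.map (toLin' (𝟙 ⊕ W))`, `W_c(τ,τ′) = (1/2M) Σ_j w_j e^{−i s_c π(2n_j+1)(τ−τ′)/(2M)}` (time convolution, diagonal in
site, spin, charge and sector slot), AFTER the tower's analysis — the same device as the source rescaling `srcScale t` of `…TowerSrcScaledDefs` (BGM §2.9).  At
any fixed Matsubara label `n` the window is `1` once `M ≥ 4|n|+2` (`srcWindowWt_eq_one`), so the END read-out is untouched; the smoothed source block has
`M`-uniform `ℓ¹` rows (`…TwoVolumeSourceWindowKernel`, `…TowerBaseSrcWindowRows`).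

* §1 `srcWindowFn`, `srcWindowWt M j`, `srcWindowFamily V M` (the window as a one-sector multiplier family), `srcSmoothPhase`, `srcSmoothKernel M c τ τ′`,
  `srcSmoothMat V M n`, `srcSmooth V M n` (+ `_apply` unfoldings, `srcWindowFn/Wt_mem_Icc/_eq_one/_eq_zero`, `srcSmoothMat_offDiag`);
* §1b `klSrcAnalysisAtW` (the windowed doubled analysis), `srcSmoothBlock`, `klSrcWindowBlock`, `klBaseTransferW` (the windowed base transfer);
* §2 the smoothed rescaled states `klTowerStateSW … t j := srcSmooth (klTowerStateS … t j)`, `klTowerDSW … t k := srcSmooth (klTowerDS … t k)`, and the keyed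
  two-volume defect `klKeyedDefectTSW` of their source truncations (`_eq`, `_nonneg`, `klTowerStateSW_zero`);
* §3 `TowerVolumeDataTSW`, `TowerDataTSW β U μ t` — `TowerVolumeDataTS` / `TowerDataTS` with the one-volume profiles and the base (H6) about the SMOOTHED states
  (everything else byte-identical).

Definitions only (plus `rfl`/elementary unfoldings); nothing about the model is asserted.  [cite: BenfattoGiulianiMastropietro2006, §2.9 (4.6)-(4.8)]
-/

noncomputable section

namespace Summit.HubbardSuperconductivity.HubbardSuperconductivity.Theorems.TwoVolumeSource

set_option linter.dupNamespace false -- summit = problem name (single-conjunct summit), D-0017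

open Finset Filter Topology Literature.MathematicalPhysics.QuantumLattice GrassmannAlgebra Literature.Probability.LatticeModels
  Literature.Probability.LatticeModels.BattleFederbush
open Summit.HubbardSuperconductivity.HubbardSuperconductivity.Theorems.KLRegimeSplit
open Summit.HubbardSuperconductivity.HubbardSuperconductivity.Theorems.KLProgrammeLegKernels
open Summit.HubbardSuperconductivity.HubbardSuperconductivity.Theorems.TwoVolumeDefect

/-! ## §1 The window, the time-smoothing kernel and the endomorphism -/

/-- **The window profile** `χ(x) = smoothTransition((4/3)(1 − x²))`: `C^∞`, values in `[0,1]`, `≡ 1` on `|x| ≤ ½`, `≡ 0` on `|x| ≥ 1` (p3 g18's keying,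
`…TowerBaseSrcWindowRows.windowBlock_wtRows_le`). [folklore] -/
def srcWindowFn (x : ℝ) : ℝ := Real.smoothTransition (4 / 3 * (1 - x ^ 2))

/-- `0 ≤ χ ≤ 1`. [folklore] -/
theorem srcWindowFn_mem_Icc (x : ℝ) : srcWindowFn x ∈ Set.Icc (0 : ℝ) 1 :=
  ⟨Real.smoothTransition.nonneg _, Real.smoothTransition.le_one _⟩

/-- `χ ≡ 1` on `|x| ≤ ½`. [folklore] -/
theorem srcWindowFn_eq_one {x : ℝ} (h : |x| ≤ 1 / 2) : srcWindowFn x = 1 := by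
  unfold srcWindowFn
  refine Real.smoothTransition.one_of_one_le ?_
  have hx2 : x ^ 2 ≤ 1 / 4 := by
    have h0 : 0 ≤ |x| := abs_nonneg x
    calc x ^ 2 = |x| ^ 2 := (sq_abs x).symm
      _ ≤ (1 / 2) ^ 2 := pow_le_pow_left₀ h0 h 2
      _ = 1 / 4 := by norm_num
  linarith

/-- `χ ≡ 0` on `1 ≤ |x|`. [folklore] -/
theorem srcWindowFn_eq_zero {x : ℝ} (h : 1 ≤ |x|) : srcWindowFn x = 0 := by
  unfold srcWindowFn
  refine Real.smoothTransition.zero_of_nonpos ?_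
  have hx2 : 1 ≤ x ^ 2 := by
    calc (1 : ℝ) = 1 ^ 2 := by norm_num
      _ ≤ |x| ^ 2 := pow_le_pow_left₀ zero_le_one h 2
      _ = x ^ 2 := sq_abs x
  linarith

/-- `χ` is smooth. [folklore] -/
theorem contDiff_srcWindowFn {n : ℕ∞} : ContDiff ℝ n srcWindowFn :=
  Real.smoothTransition.contDiff.comp (contDiff_const.mul (contDiff_const.sub (contDiff_id.pow 2)))

/-- **The frequency window** `w_j = χ((2n_j + 1)/M)` (`n_j = matsubaraInt M j`; symmetric under `n ↦ −n−1`): `1` for `|2n_j+1| ≤ M/2`, `0` at the band edge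
`|2n_j+1| ≥ M`. [folklore] -/
def srcWindowWt (M : ℕ) (j : MatsubaraIdx M) : ℝ :=
  srcWindowFn ((2 * (matsubaraInt M j : ℝ) + 1) / M)

/-- `0 ≤ w_j ≤ 1`. [folklore] -/
theorem srcWindowWt_mem_Icc (M : ℕ) (j : MatsubaraIdx M) : srcWindowWt M j ∈ Set.Icc (0 : ℝ) 1 :=
  srcWindowFn_mem_Icc _

/-- **The window is `1` in the inner quarter band**: `|2n_j+1| ≤ M/2 ⇒ w_j = 1` (so a read label `n` is untouched once `M ≥ 4|n|+2`). [folklore] -/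
theorem srcWindowWt_eq_one {M : ℕ} {j : MatsubaraIdx M} (h : |2 * (matsubaraInt M j : ℝ) + 1| ≤ (M : ℝ) / 2) : srcWindowWt M j = 1 := by
  unfold srcWindowWt
  rcases Nat.eq_zero_or_pos M with hM | hM
  · exfalso
    have := j.2
    omega
  have hMr : (0 : ℝ) < M := by exact_mod_cast hM
  refine srcWindowFn_eq_one ?_
  rw [abs_div, abs_of_pos hMr, div_le_iff₀ hMr]
  linarith

/-- **The window vanishes at the band edge**: `M ≤ |2n_j+1| ⇒ w_j = 0`. [folklore] -/
theorem srcWindowWt_eq_zero {M : ℕ} (hM : 0 < M) {j : MatsubaraIdx M} (h : (M : ℝ) ≤ |2 * (matsubaraInt M j : ℝ) + 1|) : srcWindowWt M j = 0 := by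
  unfold srcWindowWt
  have hMr : (0 : ℝ) < M := by exact_mod_cast hM
  refine srcWindowFn_eq_zero ?_
  rw [abs_div, abs_of_pos hMr, le_div_iff₀ hMr, one_mul]
  exact h

/-- **The window as a (one-sector) multiplier family** `F_χ(k) = w_{k₀} = χ((2k₀+1−2M)/M)` (p3 g18's keying of `…TowerBaseSrcWindowRows.windowBlock_wtRows_le`). -/
def srcWindowFamily (V M : ℕ) : Fin 1 → FreqMomentum V M → ℂ := fun _ k => ((srcWindowWt M k.1 : ℝ) : ℂ)

/-- `F_χ(k) = χ((2·k₀ + 1 − 2M)/M)` with `k₀ : ℕ` the Matsubara index (the form of `windowBlock_wtRows_le`'s hypothesis `hF`). [folklore] -/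
theorem srcWindowFamily_apply (V M : ℕ) (ω : Fin 1) (k : FreqMomentum V M) :
    srcWindowFamily V M ω k = ((srcWindowFn ((2 * ((k.1 : ℕ) : ℝ) + 1 - 2 * M) / M) : ℝ) : ℂ) := by
  unfold srcWindowFamily srcWindowWt matsubaraInt
  push_cast
  ring_nf

/-- The `β`-free time phase `π(2n_j+1)(τ − τ′)/(2M)` (`= ω_j·(t_τ − t_{τ′})`). [folklore] -/
def srcSmoothPhase (M : ℕ) (j : MatsubaraIdx M) (τ τ' : ImagTimeIdx M) : ℝ :=
  Real.pi * (2 * (matsubaraInt M j : ℝ) + 1) * (((τ : ℕ) : ℝ) - ((τ' : ℕ) : ℝ)) / (2 * M)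

/-- **The time-smoothing kernel of charge `c`**: `W_c(τ,τ′) = (1/2M)·Σ_j w_j·e^{−i s_c π(2n_j+1)(τ−τ′)/(2M)}`. [cite: BenfattoGiulianiMastropietro2006, §2.9 (4.6)] -/
def srcSmoothKernel (M : ℕ) (c : Fin 2) (τ τ' : ImagTimeIdx M) : ℂ :=
  ((1 / (2 * (M : ℝ)) : ℝ) : ℂ) * ∑ j : MatsubaraIdx M, ((srcWindowWt M j : ℝ) : ℂ) * Complex.exp (-((chargeSign c * srcSmoothPhase M j τ τ' : ℝ) : ℂ) * Complex.I)

/-- **The smoothing matrix on the doubled labels**: identity on the alive copy `0`; on the source copy `1` the time kernel `W_c`, diagonal in site, sector slot,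
spin and charge. [cite: BenfattoGiulianiMastropietro2006, §2.9 (4.6)] -/
def srcSmoothMat (V M n : ℕ) : Matrix (SrcLabel V M n) (SrcLabel V M n) ℂ :=
  Matrix.of fun p q =>
    if p.2 = 0 ∧ q.2 = 0 then (if p.1 = q.1 then 1 else 0)
    else if p.2 = 1 ∧ q.2 = 1 then
      (if p.1.1.2 = q.1.1.2 ∧ p.1.2 = q.1.2 then srcSmoothKernel M p.1.2.2 p.1.1.1 q.1.1.1 else 0)
    else 0

/-- Entries of the smoothing matrix. [folklore] -/
theorem srcSmoothMat_apply (V M n : ℕ) (p q : SrcLabel V M n) :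
    srcSmoothMat V M n p q =
      if p.2 = 0 ∧ q.2 = 0 then (if p.1 = q.1 then 1 else 0)
      else if p.2 = 1 ∧ q.2 = 1 then
        (if p.1.1.2 = q.1.1.2 ∧ p.1.2 = q.1.2 then srcSmoothKernel M p.1.2.2 p.1.1.1 q.1.1.1 else 0)
      else 0 := rfl

/-- The smoothing matrix is copy-diagonal. [folklore] -/
theorem srcSmoothMat_offDiag (V M n : ℕ) (x : SpaceTimeIdx V M × SectorLeg (sectorCount n)) (s : Fin 2)
    (y : SpaceTimeIdx V M × SectorLeg (sectorCount n)) (t : Fin 2) (hst : s ≠ t) : srcSmoothMat V M n (x, s) (y, t) = 0 := by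
  rw [srcSmoothMat_apply]
  have h0 : ¬(s = 0 ∧ t = 0) := fun h => hst (h.1.trans h.2.symm)
  have h1 : ¬(s = 1 ∧ t = 1) := fun h => hst (h.1.trans h.2.symm)
  simp only [h0, h1, if_false]

variable (V M : ℕ) [NeZero V]

/-- **`srcSmooth V M n`** — the source-smoothing endomorphism of the doubled scale-`n` algebra. [cite: BenfattoGiulianiMastropietro2006, §2.9 (4.6)-(4.8)] -/
def srcSmooth (n : ℕ) : GrassmannAlgebra ℂ (SrcLabel V M n) →ₐ[ℂ] GrassmannAlgebra ℂ (SrcLabel V M n) :=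
  ExteriorAlgebra.map (Matrix.toLin' (srcSmoothMat V M n))

/-- Unfolding `srcSmooth`. [folklore] -/
theorem srcSmooth_apply (n : ℕ) (F : GrassmannAlgebra ℂ (SrcLabel V M n)) :
    srcSmooth V M n F = ExteriorAlgebra.map (Matrix.toLin' (srcSmoothMat V M n)) F := rfl

/-! ## §1b The windowed doubled analysis (what the smoothing does to `klSrcAnalysisAt`) -/

section Analysis

variable (L M : ℕ) [NeZero L]

/-- **The windowed doubled analysis matrix**: copy `0` ↦ `E(F_J)` (unchanged), copy `1`, sector slot `0` ↦ `E(F_χ)` (the plain field smoothed in time), other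
slots ↦ `0`; `srcSmoothMat · klSrcAnalysisAt = klSrcAnalysisAtW` (`…TwoVolumeSourceSmoothAnalysis`). -/
def klSrcAnalysisAtW (β μ : ℝ) (K : TrigPolyC4v) (J : ℕ) : Matrix (SrcLabel L M J) (HubbardFieldIdx L M) ℂ :=
  Matrix.of fun Y X => if Y.2 = 0 then sectorAnalysisMatrix L M β (klAnisoFamily L M β μ K klE0 J) Y.1 X
    else if (Y.1.2.1.1 : ℕ) = 0 then sectorAnalysisMatrix L M β (srcWindowFamily L M) (Y.1.1, (((0 : Fin 1), Y.1.2.1.2), Y.1.2.2)) X else 0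


/-- **The copy-`1` block of the smoothing** (time kernel, diagonal in site and sector leg). -/
def srcSmoothBlock (n : ℕ) : Matrix (SpaceTimeIdx L M × SectorLeg (sectorCount n)) (SpaceTimeIdx L M × SectorLeg (sectorCount n)) ℂ :=
  fun Y Y' => srcSmoothMat L M n (Y, 1) (Y', 1)

/-- **The ε-scaled WINDOWED source block at sector slot `0`** (`klSrcPlainBlock` with `trivialMultiplier ↦ srcWindowFamily`). -/
def klSrcWindowBlock (β : ℝ) : Matrix (SpaceTimeIdx L M × SectorLeg (sectorCount 0)) (HubbardFieldIdx L M) ℂ :=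
  Matrix.of fun Y X => if (Y.2.1.1 : ℕ) = 0 then (((imagTimeWeight β M : ℝ) : ℂ)) *
    sectorAnalysisMatrix L M β (srcWindowFamily L M) (Y.1, (((0 : Fin 1), Y.2.1.2), Y.2.2)) X else 0

/-- **The windowed base transfer** `T⁺_base^W = (ε • E(F_0[K])·S_N) ⊕ (klSrcWindowBlock·S_N)` (`klBaseTransfer` with the windowed source block);
`srcSmoothMat · klBaseTransfer = klBaseTransferW` (`…TwoVolumeSourceSmoothAnalysis`). -/
def klBaseTransferW (β μ : ℝ) (K : TrigPolyC4v) : Matrix (SrcLabel L M 0) (GridLeg (GridPoint L (klGridN M)) × Fin 2) ℂ :=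
  Matrix.of fun p' p =>
    if p'.2 = 0 ∧ p.2 = 0 then
      ((((imagTimeWeight β M : ℝ) : ℂ) • sectorAnalysisMatrix L M β (klAnisoFamily L M β μ K klE0 0)) * hubbardGridSub L M β (klGridN M)) p'.1 p.1
    else if p'.2 = 1 ∧ p.2 = 1 then (klSrcWindowBlock L M β * hubbardGridSub L M β (klGridN M)) p'.1 p.1 else 0

variable {L M}

omit [NeZero L] in
/-- Entries of the windowed doubled analysis. -/
theorem klSrcAnalysisAtW_apply (β μ : ℝ) (K : TrigPolyC4v) (J : ℕ) (Y : SrcLabel L M J) (X : HubbardFieldIdx L M) :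
    klSrcAnalysisAtW L M β μ K J Y X = if Y.2 = 0 then sectorAnalysisMatrix L M β (klAnisoFamily L M β μ K klE0 J) Y.1 X
      else if (Y.1.2.1.1 : ℕ) = 0 then sectorAnalysisMatrix L M β (srcWindowFamily L M) (Y.1.1, (((0 : Fin 1), Y.1.2.1.2), Y.1.2.2)) X else 0 := rfl

end Analysis

/-! ## §2 The smoothed rescaled states and their keyed two-volume defect -/

section States

variable (L M : ℕ) [NeZero L]

/-- **The smoothed rescaled state of step `j`**: `srcSmooth (klTowerStateS … t j)`. -/
def klTowerStateSW (β U μ : ℝ) (K : TrigPolyC4v) (t : ℝ) (j : ℕ) : GrassmannAlgebra ℂ (SrcLabel L M (j - 1)) :=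
  srcSmooth L M (j - 1) (klTowerStateS L M β U μ K t j)

/-- **The smoothed rescaled source-carrying action of step `k`**: `srcSmooth (klTowerDS … t k)`. -/
def klTowerDSW (β U μ : ℝ) (K : TrigPolyC4v) (t : ℝ) (k : ℕ) : GrassmannAlgebra ℂ (SrcLabel L M k) :=
  srcSmooth L M k (klTowerDS L M β U μ K t k)

variable {L M}

/-- Unfolding `klTowerStateSW`. -/
theorem klTowerStateSW_eq (β U μ : ℝ) (K : TrigPolyC4v) (t : ℝ) (j : ℕ) :
    klTowerStateSW L M β U μ K t j = srcSmooth L M (j - 1) (klTowerStateS L M β U μ K t j) := rfl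

/-- Unfolding `klTowerDSW`. -/
theorem klTowerDSW_eq (β U μ : ℝ) (K : TrigPolyC4v) (t : ℝ) (k : ℕ) :
    klTowerDSW L M β U μ K t k = srcSmooth L M k (klTowerDS L M β U μ K t k) := rfl

/-- Step `0` of the smoothed states. -/
theorem klTowerStateSW_zero (β U μ : ℝ) (K : TrigPolyC4v) (t : ℝ) : klTowerStateSW L M β U μ K t 0 = klTowerDSW L M β U μ K t 0 := rfl

end States

section Defect

variable (L b M : ℕ) [NeZero L] [NeZero (b * L)]

/-- **The keyed two-volume defect of the SMOOTHED source-truncated rescaled states** at step `j` (shape of `klKeyedDefectTS` with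
`srcTrunc 3 (klTowerStateS …)` ↦ `srcTrunc 3 (klTowerStateSW …)`). [cite: BenfattoGiulianiMastropietro2006, §2.9 (4.3)-(4.8)] -/
def klKeyedDefectTSW (β U μ : ℝ) (Kc Kf : TrigPolyC4v) (t : ℝ) (j k : ℕ) (p : Fin k) (w : SrcLabel (b * L) M (j - 1)) : ℝ :=
  ∑ X ∈ univ.filter (fun X : Fin k → SrcLabel (b * L) M (j - 1) => X p = w),
    ‖kernel ℂ (srcTrunc ℂ (fun Y : SrcLabel (b * L) M (j - 1) => Y.2 = 1) 3 (klTowerStateSW (b * L) M β U μ Kf t j)) k X -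
      (if ∀ i, (klBlockEquivD L b M (j - 1) (X i)).1 = (klBlockEquivD L b M (j - 1) (X p)).1 then
        kernel ℂ (srcTrunc ℂ (fun Y : SrcLabel L M (j - 1) => Y.2 = 1) 3 (klTowerStateSW L M β U μ Kc t j)) k
          (fun i => (klBlockEquivD L b M (j - 1) (X i)).2) else 0)‖

variable {L b M}

/-- Unfolding `klKeyedDefectTSW`. -/
theorem klKeyedDefectTSW_eq (β U μ : ℝ) (Kc Kf : TrigPolyC4v) (t : ℝ) (j k : ℕ) (p : Fin k) (w : SrcLabel (b * L) M (j - 1)) :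
    klKeyedDefectTSW L b M β U μ Kc Kf t j k p w =
      ∑ X ∈ univ.filter (fun X : Fin k → SrcLabel (b * L) M (j - 1) => X p = w),
        ‖kernel ℂ (srcTrunc ℂ (fun Y : SrcLabel (b * L) M (j - 1) => Y.2 = 1) 3 (klTowerStateSW (b * L) M β U μ Kf t j)) k X -
          (if ∀ i, (klBlockEquivD L b M (j - 1) (X i)).1 = (klBlockEquivD L b M (j - 1) (X p)).1 then
            kernel ℂ (srcTrunc ℂ (fun Y : SrcLabel L M (j - 1) => Y.2 = 1) 3 (klTowerStateSW L M β U μ Kc t j)) k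
              (fun i => (klBlockEquivD L b M (j - 1) (X i)).2) else 0)‖ := rfl

/-- `0 ≤ klKeyedDefectTSW`. -/
theorem klKeyedDefectTSW_nonneg (β U μ : ℝ) (Kc Kf : TrigPolyC4v) (t : ℝ) (j k : ℕ) (p : Fin k) (w : SrcLabel (b * L) M (j - 1)) :
    0 ≤ klKeyedDefectTSW L b M β U μ Kc Kf t j k p w :=
  sum_nonneg fun _ _ => norm_nonneg _

end Defect

/-! ## §3 The smoothed one-volume bundle and data package -/

section Package

/-- **`TowerVolumeDataTSW V M β U μ K J ε t Λ κ aW sW NV`** — `TowerVolumeDataTS` with E1's even weighted profiles asked of the source-truncated SMOOTHED rescaled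
read-outs `srcTrunc 3 (klTowerDSW V … K t j)`. -/
structure TowerVolumeDataTSW (V M : ℕ) [NeZero V] (β U μ : ℝ) (K : TrigPolyC4v) (J : ℕ) (ε t : ℝ) (Λ κ aW sW : ℕ → ℝ) (NV : ℕ → ℕ → ℝ) : Prop where
  /-- partition functions of the integrated scales -/
  Z : ∀ k, k + 1 ≤ J → hubbardEffPartitionFnCT V M β U μ 0 K (klScale klE0 (k + 1)) ≠ 0
  /-- parity of the (unscaled) read-outs -/
  parity : ∀ j, j ≤ J → klTowerD V M β U μ K j ∈ evenOdd ℂ 0 ∧ constPart ℂ (klTowerD V M β U μ K j) = 0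
  /-- step-covariance bundles -/
  cov : ∀ j, j < J → ScaleCovData (klStepCov V M β μ K j) (Λ j) (κ j) (aW j / ε) (sW j)
  /-- E1's even weighted profiles (normalised) of the source-truncated SMOOTHED rescaled read-outs -/
  profile : ∀ j, j ≤ J → WtProfileEven (srcTrunc ℂ (fun q : SrcLabel V M j => q.2 = 1) 3 (klTowerDSW V M β U μ K t j)) (Λ j) (fun m => ε * NV j m)

/-- **`TowerDataTSW β U μ t`** — `TowerDataTS β U μ t` with the one-volume bundles `TowerVolumeDataTSW … t` and the base (H6) about the keyed defect of the
source-truncated SMOOTHED rescaled step-`0` states (everything else byte-identical: constants, (H1)–(H4), `TowerCrossData`). -/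
structure TowerDataTSW (β U μ t : ℝ) where
  /-- Matsubara-cutoff threshold of an admissible instance `(L, b, M)`: `Mth L b ≤ M` -/
  Mth : ℕ → ℕ → ℕ
  /-- the depth schedule `r_L → ∞` with `2·(2(J+1)·r_L + r_L) < L`, `J = nScales β` -/
  r : ℕ → ℕ
  hr : Tendsto r atTop atTop
  hRd : ∀ L, 0 < L → 2 * (2 * (nScales β + 1) * r L + r L) < L
  /-- volume-free constants per scale -/
  Λ : ℕ → ℝ
  κ : ℕ → ℝ
  aW : ℕ → ℝ
  sW : ℕ → ℝ
  κ' : ℕ → ℝ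
  aW' : ℕ → ℝ
  sW' : ℕ → ℝ
  eW' : ℕ → ℝ
  ΛT : ℕ → ℝ
  cW : ℕ → ℝ
  κf : ℕ → ℝ
  cRb : ℕ → ℝ
  cCb : ℕ → ℝ
  δb : ℕ → ℝ
  ρ₀ : ℕ → ℝ
  ρf : ℕ → ℝ
  ρ₂ : ℕ → ℝ
  ρ' : ℕ → ℝ
  ρ₃ : ℕ → ℝ
  ν₀ : ℕ → ℝ
  ν₁ : ℕ → ℝ
  ν₂ : ℕ → ℝ
  ν₃ : ℕ → ℝ
  ν₄ : ℕ → ℝ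
  ν₅ : ℕ → ℝ
  νE : ℕ → ℝ
  ν₆ : ℕ → ℝ
  ν₇ : ℕ → ℝ
  ν₈ : ℕ → ℝ
  /-- E1's L-free even budgets `NV j m` (of the rescaled read-outs) and the raw budgets `NS j k` of the rescaled states -/
  NV : ℕ → ℕ → ℝ
  NS : ℕ → ℕ → ℝ
  /-- the frame-mismatch rates (scale `j`, coarse volume `L`) -/
  sE : ℕ → ℕ → ℝ
  cR : ℕ → ℕ → ℝ
  cC : ℕ → ℕ → ℝ
  δ : ℕ → ℕ → ℝ
  /-- (H1) signs -/
  hΛ : ∀ j, 0 < Λ j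
  hΛmono : ∀ j, Λ (j + 1) ≤ Λ j
  hΛT : ∀ j, Λ j ≤ ΛT j
  hκ : ∀ j, 0 < κ j ∧ 0 < κ' j ∧ 0 < κf j
  haW : ∀ j, 0 ≤ aW j ∧ 0 ≤ aW' j ∧ 0 ≤ sW j ∧ 0 ≤ sW' j ∧ 0 ≤ eW' j ∧ 0 ≤ cW j ∧ 0 ≤ δb j
  hρ : ∀ j, 0 < ρ₀ j ∧ 0 < ρf j ∧ 0 < ρ₂ j ∧ 0 < ρ' j ∧ 0 < ρ₃ j
  hNV0 : ∀ j m, 0 ≤ NV j m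
  hNSnn : ∀ j k, 0 ≤ NS j k
  /-- (H2) the raw-budget recursion -/
  hNS0 : ∀ k, NS 0 k = if Even k then NV 0 (k / 2) else 0
  hNSsucc : ∀ j k, j < nScales β → NS (j + 1) k = (ρ₀ j)⁻¹ ^ k * (Real.exp 1 * ν₀ j) / (1 - Real.exp 1 * aW j * ν₀ j / κ j ^ 2)
  /-- (H3) volume-free smallness of every step -/
  hsm : ∀ j, j < nScales β → TowerScaleSmall (κ j) (κ' j) (aW j) (aW' j) (cW j) (κf j) (cRb j) (cCb j) (δb j) (ρ₀ j) (ρf j) (ρ₂ j) (ρ' j) (ρ₃ j) (NV j) (NS j)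
    (ν₀ j) (ν₁ j) (ν₂ j) (ν₃ j) (ν₄ j) (ν₅ j) (νE j) (ν₆ j) (ν₇ j) (ν₈ j)
  /-- (H4) the mismatch rates: signs, caps, limits -/
  hmis : ∀ j L, 0 ≤ sE j L ∧ 0 ≤ cR j L ∧ 0 ≤ cC j L ∧ 0 ≤ δ j L ∧ cR j L ≤ cRb j ∧ cC j L ≤ cCb j ∧ δ j L ≤ δb j
  hmis0 : ∀ j, Tendsto (sE j) atTop (𝓝 0) ∧ Tendsto (cR j) atTop (𝓝 0) ∧ Tendsto (cC j) atTop (𝓝 0) ∧ Tendsto (δ j) atTop (𝓝 0)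
  /-- (H5) the three data bundles (one-volume bundles source-truncated, SMOOTHED and rescaled by `t`), eventually in `L`, at every admissible instance, at the flow frames -/
  hdata : ∀ᶠ L in atTop, ∀ (b M : ℕ) [NeZero L] [NeZero (b * L)] [NeZero M], Mth L b ≤ M →
    TowerVolumeDataTSW L M β U μ (klFlowFrameU L M β U μ (nScales β + 1)) (nScales β) (imagTimeWeight β M) t Λ κ aW sW NV ∧
      TowerVolumeDataTSW (b * L) M β U μ (klFlowFrameU (b * L) M β U μ (nScales β + 1)) (nScales β) (imagTimeWeight β M) t Λ κ aW sW NV ∧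
        TowerCrossData L b M β μ (klFlowFrameU L M β U μ (nScales β + 1)) (klFlowFrameU (b * L) M β U μ (nScales β + 1)) (nScales β) (imagTimeWeight β M)
          Λ κ' aW' sW' eW' ΛT cW κf (fun j => sE j L) (fun j => cR j L) (fun j => cC j L) (fun j => δ j L)
  /-- (H6) the BASE: the keyed defect of the source-truncated SMOOTHED rescaled step-`0` states at the `2 r_L`-deep pins tends to zero uniformly in the instance -/
  h0 : ∀ (k : ℕ) (η : ℝ), 0 < η → ∀ᶠ L in atTop, ∀ (b M : ℕ) [NeZero L] [NeZero (b * L)] [NeZero M], Mth L b ≤ M →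
    ∀ (p : Fin k) (w : SrcLabel (b * L) M 0), (∀ i, 2 * r L ≤ (w.1.1.2 i).val % L ∧ (w.1.1.2 i).val % L + 2 * r L < L) →
      klKeyedDefectTSW L b M β U μ (klFlowFrameU L M β U μ (nScales β + 1)) (klFlowFrameU (b * L) M β U μ (nScales β + 1)) t 0 k p w ≤ imagTimeWeight β M * η


end Package

end Summit.HubbardSuperconductivity.HubbardSuperconductivity.Theorems.TwoVolumeSource

end
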